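import Summits.QuantumFields.YangMills.Theorems.UnitScaleTiltFluctuationComparisonRegPrOneTower

/-!
# Route `UnitScaleTilt` — crux K1bR-pr `FluctuationComparisonRegPr` (stmt-QuantumFields-19201), stub `stub_logComparisonRegPr`,
# layer S-D/α «SMALL-FIELD RECURSION»: the restricted height density IS Bałaban's small-field renormalisation-group recursion
# `τ_{j+1} = T_j(χ_j·τ_j)` read on the window; the transport is monotone, so envelopes can be propagated along it
# (support file `--supports stmt-QuantumFields-19201`; the stub stays open)

Fleet lead `ym-ust-19201-p1` (gen 1); split card `CARD-19201-logComparison-split.md` (evidence #16 on the item), sub-lemma **S-D**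
(per-run two-sided trivial-history envelope = [Balaban1985UV3] (41) at the trivial history + (47)), its HYPOTHESIS-FREE CARRIER.
WHAT THIS IS NOT: no estimate of Bałaban's is asserted or used; pure measure theory over the published recursion (2) with the small-field
decomposition (7) of [Balaban1985UV3], on the tree's objects (`resDensity`, `histGood`, `heightDensity`, `rt`); NO new definition (the
recursion's terms are spelled out as restricted densities of the tree: write, for readability only,
`χ_j := 1_{PlaqSmall θ(K−j)}` on the level-`j` fields of the `K`-th approximation and
`τ_j := resDensity F γ K (histGood F ℰp θ K (K−j+1)) j` = the tower restricted by the windows STRICTLY BELOW level `j`; `τ_0 = e^{−β_K A}`).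

* §1 INDICATOR FACTORISATION THROUGH THE TOWER (any initial density `ρ₀ ≥ 0`): `T^{j}(1_{(avg^j)⁻¹B}·ρ₀) = 1_B·T^{j}ρ₀` a.e.
  (`towerDensity_indicator_preimage_ae_eq`; uniqueness of densities against bounded tests, [Balaban1985Averaging] (10)).
* §2 WINDOW PEELING of the UV-small histories: `histGood θ K n = histGood θ K (n+1) ∩ (avg^{K−n})⁻¹{PlaqSmall θ(n)}` (`histGood_eq_inter_preimage`).
* §3 THE SMALL-FIELD RECURSION = THE TRIVIAL HISTORY OF (41) / THE ONLY TERM OF (47): `τ_0 = e^{−β_K A}` (`resDensity_histGood_zero_eq_boltzmann`),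
  PEEL-TOP `resDensity (histGood θ K n) j = χ_j·τ_j` a.e. for `n + j = K` (`resDensity_histGood_ae_eq_indicator_mul`), the transport respects
  a.e.-equality of non-negative densities EXACTLY (`rt_congr_ae`), hence STEP `τ_{j+1} = T_j(χ_j·τ_j)` as an identity of functions
  (`resDensity_histGood_succ_eq_rt_indicator`), and the READING at the comparison height `n`, `k = K − n`:
  `heightDensity F γ _ (histGood θ K n) = 1_{PlaqSmall θ(n)}·τ_k ∘ fieldShift` a.e. (`heightDensity_histGood_ae_eq`; on the window the
  restricted height density of the registered stub IS `τ_k`, `heightDensity_histGood_eq_on_window`).  [Balaban1985UV3] p.257 (7) and p.267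
  (47): «the term of the trivial history (no large fields …)»; p.272 «all simplifications coming from the fact that Ω_{k+1} = T_η».
* §4 POSITIVITY: `T_j` and the tower are MONOTONE a.e. (`rt_mono_ae`, `towerDensity_mono_ae`) — the mechanism by which (41)/(47) are
  propagated in print (p.266: the inductive assumption is transformed by applying `T`).
* The INDUCTION FRAME of S-D built on this carrier (envelopes exposed as data, propagated by §3 + §4) is the sibling file
  `UnitScaleTiltFluctuationComparisonRegPrSmallFieldEnvelope.lean`.

References: T. Bałaban, CMP 102 (1985) 255–275 [Balaban1985UV3] ((2) p.256, (7) p.257, (41) p.266, (47) p.267, p.272); CMP 98 (1985) 17–51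
[Balaban1985Averaging] ((10) p.19); C. King, CMP 102 (1986) 649–677 [King1986] (§3.2 p.656).
-/

noncomputable section

open MeasureTheory Filter Topology
open Literature.MathematicalPhysics.QuantumFieldTheory.Balaban1983to89
open Literature.MathematicalPhysics.QuantumFieldTheory.Balaban1983to89.T3ContinuumYM3Torus
open Literature.MathematicalPhysics.QuantumFieldTheory.Balaban1983to89.T3LevelShift
open Literature.MathematicalPhysics.QuantumFieldTheory.Balaban1983to89.T3UnitLawDensityEML
open Literature.MathematicalPhysics.QuantumFieldTheory.Balaban1983to89.T3UnitScaleTilt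
open Literature.MathematicalPhysics.QuantumFieldTheory.Balaban1983to89.T3RestrictedUnitDensity
open Literature.MathematicalPhysics.QuantumFieldTheory.Balaban1983to89.T3TiltDescent
open Literature.MathematicalPhysics.QuantumFieldTheory.Balaban1983to89.T3CruxEstimates
open Literature.MathematicalPhysics.QuantumFieldTheory.Balaban1983to89.Missing
open Literature.MathematicalPhysics.QuantumFieldTheory.Balaban1983to89.T4Continuum
open Summit.QuantumFields.YangMills.Theorems.LogComparisonOneTower (setIntegral_eq_integral_mul_indicator_one)

namespace Summit.QuantumFields.YangMills.Theorems.LogComparisonSmallFieldRecursion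

/-! ## §1 Indicator factorisation through the Radon–Nikodym tower -/

section Factorisation

variable (F : T3Family) (K : ℕ) {ρ₀ : Density (F.P K) 0 (Matrix.specialUnitaryGroup (Fin 2) ℂ)}

/-- **INDICATOR FACTORISATION THROUGH THE TOWER**: for an integrable initial density `ρ₀`, a level `j` of the standing
range and a measurable event `B` of level-`j` fields, `T_{j−1}⋯T_0(1_{(avg^j)⁻¹B}·ρ₀) = 1_B · T_{j−1}⋯T_0 ρ₀` a.e. — a constraint on the
`j`-fold averaged field passes through the `j` transports as a restriction of the result (both sides integrate every bounded measurable test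
`g` to `∫ ρ₀(U) (1_B g)(avg^j U) dU`). [cite: Balaban1985Averaging, (10) p.19] -/
theorem towerDensity_indicator_preimage_ae_eq
    (hi : Integrable ρ₀ (fieldMeasure (F.P K) 0 (Matrix.specialUnitaryGroup (Fin 2) ℂ))) {j : ℕ} (hj : j ≤ F.m + K)
    {B : Set (GaugeField (F.P K) j (Matrix.specialUnitaryGroup (Fin 2) ℂ))} (hB : MeasurableSet B) :
    towerDensity F K (((Averaging.iter (fun i => BlockAveraging.blockAvg (P := F.P K) (j := i) ℰp) j) ⁻¹' B).indicator ρ₀) j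
      =ᵐ[fieldMeasure (F.P K) j (Matrix.specialUnitaryGroup (Fin 2) ℂ)] B.indicator (towerDensity F K ρ₀ j) := by
  set itr : GaugeField (F.P K) 0 (Matrix.specialUnitaryGroup (Fin 2) ℂ) → GaugeField (F.P K) j (Matrix.specialUnitaryGroup (Fin 2) ℂ) :=
    Averaging.iter (fun i => BlockAveraging.blockAvg (P := F.P K) (j := i) ℰp) j with hitr
  have hmi : Measurable itr := measurable_iter _ (fun i => measurable_blockAvg F K i) j
  have hpre : MeasurableSet (itr ⁻¹' B) := hmi hB
  have hi₁ : Integrable (towerDensity F K ((itr ⁻¹' B).indicator ρ₀) j) (fieldMeasure (F.P K) j (Matrix.specialUnitaryGroup (Fin 2) ℂ)) :=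
    integrable_towerDensity F K (hi.indicator hpre) j hj
  have hi₂ : Integrable (B.indicator (towerDensity F K ρ₀ j)) (fieldMeasure (F.P K) j (Matrix.specialUnitaryGroup (Fin 2) ℂ)) :=
    (integrable_towerDensity F K hi j hj).indicator hB
  refine hi₁.ae_eq_of_forall_setIntegral_eq _ _ hi₂ fun s hs _ => ?_
  have hb1 : ∀ t : Set (GaugeField (F.P K) j (Matrix.specialUnitaryGroup (Fin 2) ℂ)),
      ∃ C : ℝ, ∀ V : GaugeField (F.P K) j (Matrix.specialUnitaryGroup (Fin 2) ℂ), |t.indicator (fun _ => (1 : ℝ)) V| ≤ C :=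
    fun t => ⟨1, fun V => by by_cases hV : V ∈ t <;> simp [hV]⟩
  rw [setIntegral_eq_integral_mul_indicator_one _ hs, setIntegral_eq_integral_mul_indicator_one _ hs,
    integral_towerDensity_mul F K (hi.indicator hpre) j hj _ (measurable_const.indicator hs) (hb1 s)]
  have hrhs : (fun V => B.indicator (towerDensity F K ρ₀ j) V * s.indicator (fun _ => (1 : ℝ)) V) =
      fun V => towerDensity F K ρ₀ j V * (B ∩ s).indicator (fun _ => (1 : ℝ)) V := by
    funext V
    by_cases hVB : V ∈ B
    · by_cases hVs : V ∈ s
      · rw [Set.indicator_of_mem hVB, Set.indicator_of_mem hVs, Set.indicator_of_mem (Set.mem_inter hVB hVs)]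
      · rw [Set.indicator_of_notMem hVs, Set.indicator_of_notMem (fun h : V ∈ B ∩ s => hVs h.2), mul_zero, mul_zero]
    · rw [Set.indicator_of_notMem hVB, Set.indicator_of_notMem (fun h : V ∈ B ∩ s => hVB h.1), zero_mul, mul_zero]
  rw [hrhs, integral_towerDensity_mul F K hi j hj _ (measurable_const.indicator (hB.inter hs)) (hb1 (B ∩ s))]
  refine integral_congr_ae (Eventually.of_forall fun U => ?_)
  show (itr ⁻¹' B).indicator ρ₀ U * s.indicator (fun _ => (1 : ℝ)) (itr U) = ρ₀ U * (B ∩ s).indicator (fun _ => (1 : ℝ)) (itr U)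
  by_cases hUB : itr U ∈ B
  · by_cases hUs : itr U ∈ s
    · rw [Set.indicator_of_mem (show U ∈ itr ⁻¹' B from hUB), Set.indicator_of_mem hUs,
        Set.indicator_of_mem (Set.mem_inter hUB hUs)]
    · rw [Set.indicator_of_notMem hUs, Set.indicator_of_notMem (fun h : itr U ∈ B ∩ s => hUs h.2), mul_zero, mul_zero]
  · rw [Set.indicator_of_notMem (show U ∉ itr ⁻¹' B from hUB), Set.indicator_of_notMem (fun h : itr U ∈ B ∩ s => hUB h.1),
      zero_mul, mul_zero]

end Factorisation

/-! ## §2 Window peeling of the UV-small histories -/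

section Peeling

variable (F : T3Family) (K : ℕ) (θ : ℕ → ℝ) {G : Type*} [GaugeGroup G] (ℰ : LoopAverage G)

/-- **WINDOW PEELING**: for `n + j = K`, the UV-small history with `n` free top steps is the one with `n + 1` free top steps (windows at the
levels `< j` only) cut by the window `PlaqSmall θ(n)` on the `j`-fold averaged field — [Balaban1985UV3] (7) inserted at the top constrained
level. [cite: Balaban1985UV3, (7) p.257] -/
theorem histGood_eq_inter_preimage {n j : ℕ} (hnj : n + j = K) :
    histGood F ℰ θ K n = histGood F ℰ θ K (n + 1) ∩
      (Averaging.iter (fun i => BlockAveraging.blockAvg (P := F.P K) (j := i) ℰ) j) ⁻¹' {W | PlaqSmall (θ n) W} := by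
  ext U
  simp only [histGood, Set.mem_inter_iff, Set.mem_setOf_eq, Set.mem_preimage]
  constructor
  · intro hU
    refine ⟨fun i hi => hU i (by omega), ?_⟩
    have h := hU j (by omega)
    rwa [show K - j = n by omega] at h
  · rintro ⟨hU, hj⟩ i hi
    by_cases hij : i = j
    · subst hij
      rw [show K - i = n by omega]
      exact hj
    · exact hU i (by omega)

/-- With `K + 1` free top steps no level is constrained: `histGood θ K (K+1) = univ` (the recursion starts from the bare Boltzmann weight).
[cite: Balaban1985UV3, (1) p.256] -/
theorem histGood_succ_self_eq_univ : histGood F ℰ θ K (K + 1) = Set.univ :=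
  histGood_of_lt F ℰ (Nat.lt_succ_self K)

end Peeling

/-! ## §3 The small-field recursion and its reading at the comparison height -/

section Recursion

variable (F : T3Family) (γ : ℝ) (K : ℕ) (θ : ℕ → ℝ)

/-- `τ_0 = e^{−β_K A}`: the recursion starts from the Boltzmann weight of the `K`-th approximation ([Balaban1985UV3] (1), `E = 0`).
[cite: Balaban1985UV3, (1) p.256] -/
theorem resDensity_histGood_zero_eq_boltzmann :
    resDensity F γ K (histGood F ℰp θ K (K + 1)) 0 = boltzmann (F.P K) ((F.scheme ℰp γ).β K) := by
  show (histGood F ℰp θ K (K + 1)).indicator (boltzmann (F.P K) ((F.scheme ℰp γ).β K)) = _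
  rw [histGood_succ_self_eq_univ F K θ ℰp, Set.indicator_univ]

variable {γ}

/-- **THE TRANSPORT RESPECTS A.E.-EQUALITY OF NON-NEGATIVE DENSITIES, EXACTLY**: `T_j f = T_j g` as functions for `f = g` a.e., `f, g ≥ 0`
(the tree's `T_j` is a version of the Radon–Nikodym derivative of the push-forward of `f·dU`, which only sees the measure `f·dU`).
[cite: Balaban1985Averaging, (10) p.19] -/
theorem rt_congr_ae {j : ℕ} (hj : j + 1 ≤ F.m + K) {f g : Density (F.P K) j (Matrix.specialUnitaryGroup (Fin 2) ℂ)}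
    (hf : ∀ U, 0 ≤ f U) (hg : ∀ U, 0 ≤ g U) (hfg : f =ᵐ[fieldMeasure (F.P K) j (Matrix.specialUnitaryGroup (Fin 2) ℂ)] g) :
    (rt F K j hj).T f = (rt F K j hj).T g := by
  show AveragingRT.rnTransport (BlockAveraging.blockAvg (P := F.P K) (j := j) ℰp).avg f =
    AveragingRT.rnTransport (BlockAveraging.blockAvg (P := F.P K) (j := j) ℰp).avg g
  have hwd : (fieldMeasure (F.P K) j (Matrix.specialUnitaryGroup (Fin 2) ℂ)).withDensity (fun U => ENNReal.ofReal (f U)) =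
      (fieldMeasure (F.P K) j (Matrix.specialUnitaryGroup (Fin 2) ℂ)).withDensity (fun U => ENNReal.ofReal (g U)) :=
    withDensity_congr_ae (hfg.mono fun U hU => by
      show ENNReal.ofReal (f U) = ENNReal.ofReal (g U)
      rw [hU])
  funext V
  simp only [AveragingRT.rnTransport, if_pos hf, if_pos hg, AveragingRT.rnDensity, AveragingRT.pushDensity, hwd]

/-- `T_j f` is measurable for `f ≥ 0` (a Radon–Nikodym derivative). [cite: Balaban1985Averaging, (10) p.19] -/
theorem measurable_rt {j : ℕ} (hj : j + 1 ≤ F.m + K) {f : Density (F.P K) j (Matrix.specialUnitaryGroup (Fin 2) ℂ)}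
    (hf : ∀ U, 0 ≤ f U) : Measurable ((rt F K j hj).T f) := by
  have heq : (rt F K j hj).T f = AveragingRT.rnDensity (BlockAveraging.blockAvg (P := F.P K) (j := j) ℰp).avg f := by
    funext V
    show AveragingRT.rnTransport _ f V = _
    simp only [AveragingRT.rnTransport, if_pos hf]
  rw [heq]
  exact (Measure.measurable_rnDeriv _ _).ennreal_toReal

/-- `T_j f` is integrable for `f` integrable (standing range). [cite: Balaban1985Averaging, (10) p.19] -/
theorem integrable_rt {j : ℕ} (hj : j + 1 ≤ F.m + K) {f : Density (F.P K) j (Matrix.specialUnitaryGroup (Fin 2) ℂ)}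
    (hf : Integrable f (fieldMeasure (F.P K) j (Matrix.specialUnitaryGroup (Fin 2) ℂ))) :
    Integrable ((rt F K j hj).T f) (fieldMeasure (F.P K) (j + 1) (Matrix.specialUnitaryGroup (Fin 2) ℂ)) :=
  T4FiniteEpsInhabited.integrable_rnTransport_of_ac _ (measurable_blockAvg F K j) (haarAC_blockAvg F K hj) _ hf

variable (hγ : 0 ≤ γ)
include hγ

/-- **PEEL-TOP**: for `n + j = K`, the density restricted to the UV-small history with `n` free top steps, at its top constrained level `j`, is
the window's indicator times `τ_j` (the density restricted by the windows strictly below `j`): `resDensity (histGood θ K n) j = χ_j·τ_j` a.e.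
[cite: Balaban1985UV3, (7) p.257] -/
theorem resDensity_histGood_ae_eq_indicator_mul {n j : ℕ} (hnj : n + j = K) :
    resDensity F γ K (histGood F ℰp θ K n) j =ᵐ[fieldMeasure (F.P K) j (Matrix.specialUnitaryGroup (Fin 2) ℂ)]
      {W | PlaqSmall (θ n) W}.indicator (resDensity F γ K (histGood F ℰp θ K (n + 1)) j) := by
  have hS : MeasurableSet (histGood F ℰp θ K (n + 1) :
      Set (GaugeField (F.P K) 0 (Matrix.specialUnitaryGroup (Fin 2) ℂ))) :=
    measurableSet_histGood F ℰp measurableE_ℰp θ K (n + 1)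
  have hind : (histGood F ℰp θ K n).indicator (boltzmann (F.P K) ((F.scheme ℰp γ).β K)) =
      ((Averaging.iter (fun i => BlockAveraging.blockAvg (P := F.P K) (j := i) ℰp) j) ⁻¹' {W | PlaqSmall (θ n) W}).indicator
        ((histGood F ℰp θ K (n + 1)).indicator (boltzmann (F.P K) ((F.scheme ℰp γ).β K))) := by
    rw [histGood_eq_inter_preimage F K θ ℰp hnj, Set.inter_comm, ← Set.indicator_indicator]
  show towerDensity F K ((histGood F ℰp θ K n).indicator (boltzmann (F.P K) ((F.scheme ℰp γ).β K))) j =ᵐ[_]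
    {W | PlaqSmall (θ n) W}.indicator (towerDensity F K ((histGood F ℰp θ K (n + 1)).indicator (boltzmann (F.P K) ((F.scheme ℰp γ).β K))) j)
  rw [hind]
  exact towerDensity_indicator_preimage_ae_eq F K
    ((integrable_boltzmann RegularGaugeGroup.measurable_reTr _ (F.scheme_β_nonneg ℰp hγ K)).indicator hS) (by omega)
    (measurableSet_plaqSmall _)

/-- **STEP — THE SMALL-FIELD RECURSION `τ_{j+1} = T_j(χ_j·τ_j)`** (an identity of functions): for `n + j = K`, `j + 1` in the standing range,
`resDensity (histGood θ K n) (j+1) = T_j(1_{PlaqSmall θ(n)} · resDensity (histGood θ K (n+1)) j)` — one renormalisation transformation (2)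
applied to the small-field term of (7) at level `j`; iterating from `τ_0 = e^{−β_K A}` this is the TRIVIAL HISTORY of (41) and the only term of
(47).  (The left side is `τ_{j+1}`: windows strictly below `j + 1` = windows at the levels `≤ j` = `n` free top steps.) [cite: Balaban1985UV3, (2) p.256 and (7) p.257] -/
theorem resDensity_histGood_succ_eq_rt_indicator {n j : ℕ} (hnj : n + j = K) (hj : j + 1 ≤ F.m + K) :
    resDensity F γ K (histGood F ℰp θ K n) (j + 1) =
      (rt F K j hj).T ({W | PlaqSmall (θ n) W}.indicator (resDensity F γ K (histGood F ℰp θ K (n + 1)) j)) := by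
  have hsucc : resDensity F γ K (histGood F ℰp θ K n) (j + 1) = (rt F K j hj).T (resDensity F γ K (histGood F ℰp θ K n) j) :=
    towerDensity_succ F K _ hj
  rw [hsucc]
  exact rt_congr_ae F K hj (resDensity_nonneg F γ K _ j)
    (fun W => Set.indicator_nonneg (fun W _ => resDensity_nonneg F γ K _ j W) W)
    (resDensity_histGood_ae_eq_indicator_mul F K θ hγ hnj)

/-- **READING AT THE COMPARISON HEIGHT**: for `n ≤ K`, `k = K − n`, run `K`'s restricted height density on `histGood θ K n` (the density of
the registered stub) equals a.e. the window's indicator times `τ_k` read through the level identification: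
`heightDensity F γ _ (histGood θ K n) V = 1_{PlaqSmall θ(n)}(V) · τ_k(fieldShift V)`. [cite: Balaban1985UV3, (7) p.257 and (47) p.267] -/
theorem heightDensity_histGood_ae_eq {n : ℕ} (hK : n ≤ K) :
    heightDensity F γ hK (histGood F ℰp θ K n) =ᵐ[fieldMeasure (F.P n) 0 (Matrix.specialUnitaryGroup (Fin 2) ℂ)]
      fun V => {V' : GaugeField (F.P n) 0 (Matrix.specialUnitaryGroup (Fin 2) ℂ) | PlaqSmall (θ n) V'}.indicator
        (fun V' => resDensity F γ K (histGood F ℰp θ K (n + 1)) (K - n)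
          (fieldShift (F.sitesPerDir_eq (m := F.m) (K := K) (j := K - n) (m' := F.m) (K' := n) (j' := 0) (by omega)) V')) V := by
  have hup := F.sitesPerDir_eq (m := F.m) (K := K) (j := K - n) (m' := F.m) (K' := n) (j' := 0) (by omega)
  have hpeel := resDensity_histGood_ae_eq_indicator_mul F K θ hγ (n := n) (j := K - n) (by omega)
  have hq : Measure.QuasiMeasurePreserving
      (fieldShift hup : GaugeField (F.P n) 0 (Matrix.specialUnitaryGroup (Fin 2) ℂ) → GaugeField (F.P K) (K - n) (Matrix.specialUnitaryGroup (Fin 2) ℂ))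
      (fieldMeasure (F.P n) 0 (Matrix.specialUnitaryGroup (Fin 2) ℂ)) (fieldMeasure (F.P K) (K - n) (Matrix.specialUnitaryGroup (Fin 2) ℂ)) :=
    (measurePreserving_fieldShift hup).quasiMeasurePreserving
  have h2 := hq.ae_eq_comp hpeel
  have hdef : heightDensity F γ hK (histGood F ℰp θ K n) = resDensity F γ K (histGood F ℰp θ K n) (K - n) ∘ fieldShift hup := rfl
  rw [hdef]
  refine h2.trans (Eventually.of_forall fun V => ?_)
  show {W : GaugeField (F.P K) (K - n) (Matrix.specialUnitaryGroup (Fin 2) ℂ) | PlaqSmall (θ n) W}.indicator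
      (resDensity F γ K (histGood F ℰp θ K (n + 1)) (K - n)) (fieldShift hup V) =
    {V' : GaugeField (F.P n) 0 (Matrix.specialUnitaryGroup (Fin 2) ℂ) | PlaqSmall (θ n) V'}.indicator
      (fun V' => resDensity F γ K (histGood F ℰp θ K (n + 1)) (K - n) (fieldShift hup V')) V
  by_cases hV : PlaqSmall (θ n) V
  · have hV' : PlaqSmall (θ n) (fieldShift hup V) := (plaqSmall_fieldShift F hup _ V).mpr hV
    exact (Set.indicator_of_mem hV' _).trans
      (Set.indicator_of_mem (f := fun V' => resDensity F γ K (histGood F ℰp θ K (n + 1)) (K - n) (fieldShift hup V')) hV).symm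
  · have hV' : ¬ PlaqSmall (θ n) (fieldShift hup V) := fun h => hV ((plaqSmall_fieldShift F hup _ V).mp h)
    exact (Set.indicator_of_notMem hV' _).trans
      (Set.indicator_of_notMem (f := fun V' => resDensity F γ K (histGood F ℰp θ K (n + 1)) (K - n) (fieldShift hup V')) hV).symm

/-- **ON THE WINDOW THE STUB'S DENSITY IS `τ_k`**: for a.e. `V` with `PlaqSmall θ(n) V`,
`heightDensity F γ _ (histGood θ K n) V = τ_{K−n}(fieldShift V)` — the registered stub's restricted height density of run `K` is the
small-field recursion after `K − n` steps. [cite: Balaban1985UV3, (47) p.267] -/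
theorem heightDensity_histGood_eq_on_window {n : ℕ} (hK : n ≤ K) :
    ∀ᵐ V ∂fieldMeasure (F.P n) 0 (Matrix.specialUnitaryGroup (Fin 2) ℂ), PlaqSmall (θ n) V →
      heightDensity F γ hK (histGood F ℰp θ K n) V =
        resDensity F γ K (histGood F ℰp θ K (n + 1)) (K - n)
          (fieldShift (F.sitesPerDir_eq (m := F.m) (K := K) (j := K - n) (m' := F.m) (K' := n) (j' := 0) (by omega)) V) := by
  filter_upwards [heightDensity_histGood_ae_eq F K θ hγ hK] with V hV hs
  rw [hV]
  exact Set.indicator_of_mem hs _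

end Recursion

/-! ## §4 Positivity: the transport and the tower are monotone a.e. -/

section Monotone

variable (F : T3Family) (K : ℕ)

/-- **`T_j` IS MONOTONE A.E.**: `f ≤ g` a.e. (`f, g` integrable) ⇒ `T_j f ≤ T_j g` a.e. (every set integral of `T_j f` is
`∫_{avg⁻¹ s} f ≤ ∫_{avg⁻¹ s} g`) — the positivity by which [Balaban1985UV3] propagates (41)/(47) from one step to the next (p.266).
[cite: Balaban1985UV3, (41) p.266] -/
theorem rt_mono_ae {j : ℕ} (hj : j + 1 ≤ F.m + K) {f g : Density (F.P K) j (Matrix.specialUnitaryGroup (Fin 2) ℂ)}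
    (hfi : Integrable f (fieldMeasure (F.P K) j (Matrix.specialUnitaryGroup (Fin 2) ℂ)))
    (hgi : Integrable g (fieldMeasure (F.P K) j (Matrix.specialUnitaryGroup (Fin 2) ℂ)))
    (hle : f ≤ᵐ[fieldMeasure (F.P K) j (Matrix.specialUnitaryGroup (Fin 2) ℂ)] g) :
    (rt F K j hj).T f ≤ᵐ[fieldMeasure (F.P K) (j + 1) (Matrix.specialUnitaryGroup (Fin 2) ℂ)] (rt F K j hj).T g := by
  have havg := measurable_blockAvg F K j
  refine ae_le_of_forall_setIntegral_le (integrable_rt F K hj hfi) (integrable_rt F K hj hgi) fun s hs _ => ?_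
  have hb1 : ∃ C : ℝ, ∀ V : GaugeField (F.P K) (j + 1) (Matrix.specialUnitaryGroup (Fin 2) ℂ), |s.indicator (fun _ => (1 : ℝ)) V| ≤ C :=
    ⟨1, fun V => by by_cases hV : V ∈ s <;> simp [hV]⟩
  rw [setIntegral_eq_integral_mul_indicator_one _ hs, setIntegral_eq_integral_mul_indicator_one _ hs,
    (rt F K j hj).isRT f hfi _ (measurable_const.indicator hs) hb1, (rt F K j hj).isRT g hgi _ (measurable_const.indicator hs) hb1]
  have hpre : MeasurableSet ((BlockAveraging.blockAvg (P := F.P K) (j := j) ℰp).avg ⁻¹' s) := havg hs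
  have hef : (fun U => f U * s.indicator (fun _ => (1 : ℝ)) ((BlockAveraging.blockAvg (P := F.P K) (j := j) ℰp).avg U)) =
      ((BlockAveraging.blockAvg (P := F.P K) (j := j) ℰp).avg ⁻¹' s).indicator f := by
    funext U
    by_cases hU : (BlockAveraging.blockAvg (P := F.P K) (j := j) ℰp).avg U ∈ s
    · rw [Set.indicator_of_mem hU, Set.indicator_of_mem (show U ∈ _ ⁻¹' s from hU), mul_one]
    · rw [Set.indicator_of_notMem hU, Set.indicator_of_notMem (show U ∉ _ ⁻¹' s from hU), mul_zero]
  have heg : (fun U => g U * s.indicator (fun _ => (1 : ℝ)) ((BlockAveraging.blockAvg (P := F.P K) (j := j) ℰp).avg U)) =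
      ((BlockAveraging.blockAvg (P := F.P K) (j := j) ℰp).avg ⁻¹' s).indicator g := by
    funext U
    by_cases hU : (BlockAveraging.blockAvg (P := F.P K) (j := j) ℰp).avg U ∈ s
    · rw [Set.indicator_of_mem hU, Set.indicator_of_mem (show U ∈ _ ⁻¹' s from hU), mul_one]
    · rw [Set.indicator_of_notMem hU, Set.indicator_of_notMem (show U ∉ _ ⁻¹' s from hU), mul_zero]
  rw [hef, heg]
  exact integral_mono_ae (hfi.indicator hpre) (hgi.indicator hpre)
    (hle.mono fun U hU => Set.indicator_le_indicator hU)

variable {ρ₀ ρ₀' : Density (F.P K) 0 (Matrix.specialUnitaryGroup (Fin 2) ℂ)}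

/-- **THE TOWER IS MONOTONE A.E.** in its initial density: `ρ₀ ≤ ρ₀′` a.e. ⇒ `T^{j}ρ₀ ≤ T^{j}ρ₀′` a.e. at every level of the standing range.
[cite: Balaban1985UV3, (41) p.266] -/
theorem towerDensity_mono_ae
    (hi : Integrable ρ₀ (fieldMeasure (F.P K) 0 (Matrix.specialUnitaryGroup (Fin 2) ℂ)))
    (hi' : Integrable ρ₀' (fieldMeasure (F.P K) 0 (Matrix.specialUnitaryGroup (Fin 2) ℂ)))
    (hle : ρ₀ ≤ᵐ[fieldMeasure (F.P K) 0 (Matrix.specialUnitaryGroup (Fin 2) ℂ)] ρ₀') :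
    ∀ j : ℕ, j ≤ F.m + K →
      towerDensity F K ρ₀ j ≤ᵐ[fieldMeasure (F.P K) j (Matrix.specialUnitaryGroup (Fin 2) ℂ)] towerDensity F K ρ₀' j
  | 0, _ => hle
  | j + 1, hj => by
    rw [towerDensity_succ F K _ hj, towerDensity_succ F K _ hj]
    exact rt_mono_ae F K hj
      (integrable_towerDensity F K hi j (by omega)) (integrable_towerDensity F K hi' j (by omega))
      (towerDensity_mono_ae hi hi' hle j (by omega))

end Monotone

end Summit.QuantumFields.YangMills.Theorems.LogComparisonSmallFieldRecursion

end
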